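import Literature.AlgebraicGeometry.HodgeTheory.AbelianVarietyEllipticCurveHomDualIsogeny
import HarnessLib

/-!
# Transport of endomorphisms along a homomorphism of complex elliptic curves, `ψ ↦ φ̂ ∘ ψ ∘ φ`: `tr = deg φ · tr ψ`, `deg = (deg φ)² · deg ψ`, `disc = (deg φ)² · disc ψ`; intertwined endomorphisms `φ ∘ ψ₁ = ψ₂ ∘ φ` have equal trace, degree, discriminant and number of fixed points

Layer `Literature/AlgebraicGeometry/HodgeTheory`, namespace `Literature.AlgebraicGeometry.HodgeTheory` (theorems in the `AbelianVariety` namespace).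
THEOREMS ONLY (no definition, no named fact, no instance, no notation; D-0026 net debt 0).  Sequel of `AbelianVarietyEllipticCurveHomDualIsogeny`
(g47-#1: dual pairs `φ ≫ φ' = d(φ)·𝟙`, `d(φ') = d(φ)` on `Hom(E₁, E₂)`).  Notation as there: `d(φ) = |Ker φ(ℂ)|`, `t(α) = tr(α^* | H¹(E(ℂ); ℤ))`,
and for an endomorphism `ψ` of `E₁` and a pair `φ : E₁ ⟶ E₂`, `φ' : E₂ ⟶ E₁` the TRANSPORTED endomorphism of `E₂`

  `φ' ≫ ψ ≫ φ`   («`φ ∘ ψ ∘ φ̂`» in Silverman's right-to-left notation; `(1/deg φ)·φ ∘ ψ ∘ φ̂` is the image of `ψ` under the isomorphism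
  `End⁰(E₁) ≅ End⁰(E₂)` induced by the isogeny `φ`).

THE PRINTS.  D. Mumford, *Abelian Varieties* (1970) [MumfordAV1970] §19: Thm. 4 («for `φ ∈ End X` there is a unique monic `P ∈ ℤ[t]` of degree `2g`
with `P(n) = deg(n_X − φ)` … the characteristic polynomial of `φ`», over `ℂ` that of `ρ_r(φ) = φ^*|H¹`), and p. 174 ff. (the map
`End⁰(X) → End⁰(Y)`, `ψ ↦ f ∘ ψ ∘ f⁻¹` for an isogeny `f`, `f⁻¹ = (1/n) g` for `g f = n_X`: «`End⁰(X)` depends only on the isogeny type of `X`»);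
J. S. Milne, *Abelian Varieties* (1986) [Milne1986AbelianVarieties] §12, Prop. 12.4 and Prop. 12.9 (the characteristic polynomial of an endomorphism
is that of its action on `V_ℓ`, an isogeny invariant: `V_ℓ f` conjugates `V_ℓ ψ₁` into `V_ℓ ψ₂` when `f ψ₁ = ψ₂ f`); J. H. Silverman, *The Arithmetic of
Elliptic Curves* [SilvermanAEC2009] III §6 Thm. 6.1 (a), 6.2 (a)–(b) (the dual isogeny), III §8 Prop. 8.6 («`det(φ_ℓ) = deg φ`, `tr(φ_ℓ) = 1 + deg φ −
deg(1 − φ)`», so trace and degree determine the number of fixed points `deg(1 − φ)`), V §2 Prop. 2.3; H. Lange, *Abelian Varieties over the Complex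
Numbers* [Lange2023AbelianVarietiesComplex] §1.1.2 Prop. 1.1.13 (b)–(c) (`deg(gf) = deg f deg g`, `deg f = det ρ_r(f)`) and §5.1 (the endomorphism
algebra is an isogeny invariant).  N. Bourbaki, *Algebra* [BourbakiAlgebraI1989] Ch. III §8 no. 11 (`Tr(uv) = Tr(vu)`).

## What is proved (`E₁ E₂` complex elliptic curves, `φ : E₁ ⟶ E₂`, `φ' : E₂ ⟶ E₁` with `φ ≫ φ' = d(φ)·𝟙` [and `d(φ') = d(φ)`], `ψ ψ₁ : E₁ ⟶ E₁`, `ψ₂ : E₂ ⟶ E₂`)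

* §0 (any dimensions) `hom_singularCohomology_map_comp_one'` (`(φ ≫ χ)^* = φ^* ∘ χ^*` on `H¹` for composable homomorphisms between different
  varieties), `trace_comp_comp_of_comp_eq_zsmul_id` (ANY dimensions: if
  `φ ≫ φ' = n·𝟙 A` then `t(φ' ≫ ψ ≫ φ) = n · t(ψ)` — cyclicity of the trace across `H¹(A)` and `H¹(B)`).
* §1 THE TRANSPORT `ψ ↦ φ' ≫ ψ ≫ φ`: **`trace_isogenyTransport`** (`t(φ' ≫ ψ ≫ φ) = d(φ)·t(ψ)`), **`natCard_kerPoints_isogenyTransport`** (`d(φ' ≫ ψ ≫ φ) = d(φ)²·d(ψ)`),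
  **`disc_isogenyTransport`** (`t² − 4d` scales by `d(φ)²`), `isogenyTransport_id` (`φ' ≫ 𝟙 ≫ φ = d(φ)·𝟙`), `isogenyTransport_comp` (multiplicativity up to `d(φ)`:
  `(φ'ψφ) ≫ (φ'χφ) = d(φ)·(φ' (ψ ≫ χ) φ)`), `isogenyTransport_add`, `isogenyTransport_trace_smul_id_sub` (the transport commutes with the dual-endomorphism involution
  `α ↦ α† = t(α)·𝟙 − α`), `isogenyTransport_ne_zsmul_id` (for `φ ≠ 0`, `ψ ∉ ℤ·𝟙 ⇒ φ'ψφ ∉ ℤ·𝟙`: COMPLEX MULTIPLICATION IS TRANSPORTED along isogenies).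
* §2 INTERTWINED ENDOMORPHISMS `φ ≫ ψ₂ = ψ₁ ≫ φ`, `φ ≠ 0`: **`trace_eq_of_comp_eq_comp`** (`t(ψ₁) = t(ψ₂)`), **`natCard_kerPoints_eq_of_comp_eq_comp`**
  (`d(ψ₁) = d(ψ₂)`), `natCard_kerPoints_id_sub_eq_of_comp_eq_comp` (EQUAL NUMBERS OF FIXED POINTS `|Ker(1 − ψ₁)(ℂ)| = |Ker(1 − ψ₂)(ℂ)|`),
  `disc_eq_of_comp_eq_comp`, `isogenyTransport_eq_zsmul_of_comp_eq_comp` (`φ'ψ₁φ = d(φ)·ψ₂`), `eq_zsmul_id_iff_of_comp_eq_comp` (`ψ₁ = [m] ↔ ψ₂ = [m]`).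

## SCOPE

Complex elliptic curves (`dim = 1`) for §§1–2 (the degree clause and the kernel counts use the transfer principle of the tree); §0 is stated for
arbitrary complex abelian varieties.  The `ℚ`-algebra isomorphism `End⁰(E₁) ≅ End⁰(E₂)` itself is the tree's
`Motives/AbelianVarietyEndAlgebraIsogenyInvariance` (`IsIsogenous.nonempty_endAlgebra_algEquiv`, any dimension) — cited, neither imported nor restated;
here only the INTEGRAL numerical invariants on `H¹(E(ℂ); ℤ)` are computed.  Nothing here is a case of the Hodge conjecture.

## References

* [MumfordAV1970] D. Mumford, *Abelian Varieties*, Oxford UP 1970 — §19 Thm. 4 and pp. 174–175.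
* [Milne1986AbelianVarieties] J. S. Milne, *Abelian Varieties*, in Cornell–Silverman (1986) — §12 Prop. 12.4, Prop. 12.9.
* [SilvermanAEC2009] J. H. Silverman, *The Arithmetic of Elliptic Curves*, 2nd ed., GTM 106 (2009) — III §6 Thm. 6.1 (a), 6.2 (a)–(b); III §8 Prop. 8.6;
  V §2 Prop. 2.3.
* [Lange2023AbelianVarietiesComplex] H. Lange, *Abelian Varieties over the Complex Numbers* (2023) — §1.1.2 Prop. 1.1.13 (b)–(c); §5.1.
* [BourbakiAlgebraI1989] N. Bourbaki, *Algebra I. Chapters 1–3* (1989) — Ch. III §8 no. 11.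

## Provenance

lit-hodgefound prover seat p21, generation 47, row g47-#4 (own row, claimed by path; sequel of g47-#1, g46-#1, g46-#5, g46-#10).
-/

open Function CategoryTheory Module
open Literature.AlgebraicTopology.SingularHomology

universe u

namespace Literature.AlgebraicGeometry.HodgeTheory

namespace AbelianVariety

open _root_.AlgebraicGeometry
open Literature.AlgebraicGeometry.Motives
open Literature.AlgebraicGeometry.Motives.AbelianVariety
open scoped MonObj

/-! ### §0 Plumbing in any dimension: `(φ ≫ χ)^* = φ^* ∘ χ^*`, `[n]^* = n`, and the trace of a transported endomorphism -/

section General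

variable {A B C : Motives.AbelianVariety ℂ}

/-- **`(φ ≫ χ)^* = φ^* ∘ χ^*` on `H¹(–(ℂ); ℤ)`** for composable homomorphisms `φ : A ⟶ B`, `χ : B ⟶ C` (contravariance; the tree's
`hom_singularCohomology_map_comp_one` is the case `A = B = C`). [cite: HatcherAT2002, §3.1 (induced homomorphisms)]
[cite: Lange2023AbelianVarietiesComplex, §1.1.2 (PDF p. 19)] -/
theorem hom_singularCohomology_map_comp_one' (φ : A ⟶ B) (χ : B ⟶ C) :
    (singularCohomology.map ℤ ℤ (AlgPoints.mapContinuous (L := ℂ) (φ ≫ χ).hom.hom.hom) 1).hom =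
      (singularCohomology.map ℤ ℤ (AlgPoints.mapContinuous (L := ℂ) φ.hom.hom.hom) 1).hom ∘ₗ
        (singularCohomology.map ℤ ℤ (AlgPoints.mapContinuous (L := ℂ) χ.hom.hom.hom) 1).hom := by
  change (singularCohomology.map ℤ ℤ (AlgPoints.mapContinuous (L := ℂ) (φ.hom.hom.hom ≫ χ.hom.hom.hom)) 1).hom = _
  rw [AlgPoints.mapContinuous_comp, singularCohomology.map_comp, ModuleCat.hom_comp]

/-- Plumbing: `t(n·ψ) = n·t(ψ)`. [cite: Lange2023AbelianVarietiesComplex, §1.1.2 (PDF p. 19)] -/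
private theorem trace_zsmul' {A : Motives.AbelianVariety ℂ} (n : ℤ) (ψ : A ⟶ A) :
    LinearMap.trace ℤ _ (singularCohomology.map ℤ ℤ (AlgPoints.mapContinuous (L := ℂ) (n • ψ).hom.hom.hom) 1).hom =
      n * LinearMap.trace ℤ _ (singularCohomology.map ℤ ℤ (AlgPoints.mapContinuous (L := ℂ) ψ.hom.hom.hom) 1).hom := by
  rw [singularCohomology_int_map_zsmul_one, ModuleCat.hom_zsmul, map_zsmul (LinearMap.trace ℤ (singularCohomology ℤ ℤ (ComplexPoints A.X) 1)),
    smul_eq_mul]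

/-- **`t(φ' ≫ ψ ≫ φ) = n · t(ψ)` whenever `φ ≫ φ' = n·𝟙 A`** (ANY dimensions; `φ : A ⟶ B`, `φ' : B ⟶ A`, `ψ ∈ End(A)`):
`tr(φ'^* ψ^* φ^* | H¹(B)) = tr(ψ^* φ^* φ'^* | H¹(A)) = tr(ψ^* (φ ≫ φ')^*) = n · tr(ψ^*)` — cyclicity of the trace across two lattices.
[cite: BourbakiAlgebraI1989, Ch. III §8 no. 11 (`Tr(uv) = Tr(vu)`)] [cite: MumfordAV1970, §19 pp. 174–175] -/
theorem trace_comp_comp_of_comp_eq_zsmul_id {φ : A ⟶ B} {φ' : B ⟶ A} {n : ℤ} (hφ : φ ≫ φ' = n • 𝟙 A) (ψ : A ⟶ A) :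
    LinearMap.trace ℤ _ (singularCohomology.map ℤ ℤ (AlgPoints.mapContinuous (L := ℂ) (φ' ≫ ψ ≫ φ).hom.hom.hom) 1).hom =
      n * LinearMap.trace ℤ _ (singularCohomology.map ℤ ℤ (AlgPoints.mapContinuous (L := ℂ) ψ.hom.hom.hom) 1).hom := by
  haveI := free_singularCohomology_int A 1
  haveI := finite_singularCohomology_int A 1
  haveI := free_singularCohomology_int B 1
  haveI := finite_singularCohomology_int B 1
  rw [hom_singularCohomology_map_comp_one' φ' (ψ ≫ φ), hom_singularCohomology_map_comp_one' ψ φ, ← LinearMap.trace_comp_comm',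
    LinearMap.comp_assoc, ← hom_singularCohomology_map_comp_one' φ φ', ← hom_singularCohomology_map_comp_one' ψ (φ ≫ φ'), hφ,
    Preadditive.comp_zsmul, Category.comp_id, trace_zsmul']

end General

section Elliptic

variable {E₁ E₂ : Motives.AbelianVariety ℂ} (h₁ : E₁.dim = 1) (h₂ : E₂.dim = 1)
include h₁ h₂

/-! ### §1 The transport `ψ ↦ φ' ≫ ψ ≫ φ` along a dual pair -/

omit h₁ h₂ in
/-- **`t(φ' ≫ ψ ≫ φ) = d(φ) · t(ψ)`** for a dual pair `φ ≫ φ' = d(φ)·𝟙` (any dimensions). [cite: MumfordAV1970, §19 Thm. 4 and pp. 174–175]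
[cite: BourbakiAlgebraI1989, Ch. III §8 no. 11] -/
theorem trace_isogenyTransport {φ : E₁ ⟶ E₂} {φ' : E₂ ⟶ E₁} (hφ : φ ≫ φ' = (Nat.card (Hom.kerPoints (specOver ℂ ℂ) φ) : ℤ) • 𝟙 E₁) (ψ : E₁ ⟶ E₁) :
    LinearMap.trace ℤ _ (singularCohomology.map ℤ ℤ (AlgPoints.mapContinuous (L := ℂ) (φ' ≫ ψ ≫ φ).hom.hom.hom) 1).hom =
      Nat.card (Hom.kerPoints (specOver ℂ ℂ) φ) * LinearMap.trace ℤ _ (singularCohomology.map ℤ ℤ (AlgPoints.mapContinuous (L := ℂ) ψ.hom.hom.hom) 1).hom :=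
  trace_comp_comp_of_comp_eq_zsmul_id hφ ψ

/-- **`d(φ' ≫ ψ ≫ φ) = d(φ)² · d(ψ)`** for a dual pair with degree clause (`deg` is multiplicative on elliptic curves, `deg φ̂ = deg φ`).
[cite: Lange2023AbelianVarietiesComplex, §1.1.2 Prop. 1.1.13 (b)] [cite: SilvermanAEC2009, III §6 Thm. 6.2 (e)] -/
theorem natCard_kerPoints_isogenyTransport {φ : E₁ ⟶ E₂} {φ' : E₂ ⟶ E₁}
    (hφd : Nat.card (Hom.kerPoints (specOver ℂ ℂ) φ') = Nat.card (Hom.kerPoints (specOver ℂ ℂ) φ)) (ψ : E₁ ⟶ E₁) :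
    Nat.card (Hom.kerPoints (specOver ℂ ℂ) (φ' ≫ ψ ≫ φ)) =
      Nat.card (Hom.kerPoints (specOver ℂ ℂ) φ) ^ 2 * Nat.card (Hom.kerPoints (specOver ℂ ℂ) ψ) := by
  rw [natCard_kerPoints_comp_of_dim_eq_one h₂ h₁ φ' (ψ ≫ φ), natCard_kerPoints_comp_of_dim_eq_one h₁ h₁ ψ φ, hφd]
  ring

/-- **The discriminant scales by `d(φ)²`: `t(φ'ψφ)² − 4 d(φ'ψφ) = d(φ)² · (t(ψ)² − 4 d(ψ))`** — the transported endomorphism generates the same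
imaginary quadratic field. [cite: MumfordAV1970, §19 pp. 174–175 («`End⁰(X)` depends only on the isogeny type»)] [cite: SilvermanAEC2009, V §2 Prop. 2.3] -/
theorem disc_isogenyTransport {φ : E₁ ⟶ E₂} {φ' : E₂ ⟶ E₁} (hφ : φ ≫ φ' = (Nat.card (Hom.kerPoints (specOver ℂ ℂ) φ) : ℤ) • 𝟙 E₁)
    (hφd : Nat.card (Hom.kerPoints (specOver ℂ ℂ) φ') = Nat.card (Hom.kerPoints (specOver ℂ ℂ) φ)) (ψ : E₁ ⟶ E₁) :
    LinearMap.trace ℤ _ (singularCohomology.map ℤ ℤ (AlgPoints.mapContinuous (L := ℂ) (φ' ≫ ψ ≫ φ).hom.hom.hom) 1).hom ^ 2 -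
        4 * Nat.card (Hom.kerPoints (specOver ℂ ℂ) (φ' ≫ ψ ≫ φ)) =
      (Nat.card (Hom.kerPoints (specOver ℂ ℂ) φ) : ℤ) ^ 2 *
        (LinearMap.trace ℤ _ (singularCohomology.map ℤ ℤ (AlgPoints.mapContinuous (L := ℂ) ψ.hom.hom.hom) 1).hom ^ 2 -
          4 * Nat.card (Hom.kerPoints (specOver ℂ ℂ) ψ)) := by
  rw [trace_isogenyTransport hφ, natCard_kerPoints_isogenyTransport h₁ h₂ hφd]
  push_cast
  ring

/-- **`φ' ≫ 𝟙 ≫ φ = d(φ)·𝟙 E₂`**: the transport of the identity (so `ψ ↦ (1/deg φ)·φ'ψφ` is unital on `End⁰`). [cite: SilvermanAEC2009, III §6 Thm. 6.2 (a)]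
[cite: MumfordAV1970, §19 pp. 174–175] -/
theorem isogenyTransport_id {φ : E₁ ⟶ E₂} {φ' : E₂ ⟶ E₁} (hφ : φ ≫ φ' = (Nat.card (Hom.kerPoints (specOver ℂ ℂ) φ) : ℤ) • 𝟙 E₁) :
    φ' ≫ 𝟙 E₁ ≫ φ = (Nat.card (Hom.kerPoints (specOver ℂ ℂ) φ) : ℤ) • 𝟙 E₂ := by
  rw [Category.id_comp]
  exact (comp_eq_natCard_kerPoints_zsmul_id_comm h₁ h₂ φ φ').1 hφ

omit h₁ h₂ in
/-- **Multiplicativity up to `d(φ)`: `(φ'ψφ) ≫ (φ'χφ) = d(φ) · φ'(ψ ≫ χ)φ`** (`φ φ̂ = [deg φ]` in the middle). [cite: MumfordAV1970, §19 pp. 174–175]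
[cite: SilvermanAEC2009, III §6 Thm. 6.2 (a)] -/
theorem isogenyTransport_comp {φ : E₁ ⟶ E₂} {φ' : E₂ ⟶ E₁} (hφ : φ ≫ φ' = (Nat.card (Hom.kerPoints (specOver ℂ ℂ) φ) : ℤ) • 𝟙 E₁) (ψ χ : E₁ ⟶ E₁) :
    (φ' ≫ ψ ≫ φ) ≫ (φ' ≫ χ ≫ φ) = (Nat.card (Hom.kerPoints (specOver ℂ ℂ) φ) : ℤ) • (φ' ≫ (ψ ≫ χ) ≫ φ) := by
  simp only [Category.assoc]
  rw [← Category.assoc φ φ', hφ, Preadditive.zsmul_comp, Category.id_comp, Preadditive.comp_zsmul, Preadditive.comp_zsmul]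

omit h₁ h₂ in
/-- Additivity of the transport: `φ'(ψ + χ)φ = φ'ψφ + φ'χφ`. [cite: MumfordAV1970, §19 pp. 174–175] -/
theorem isogenyTransport_add (φ : E₁ ⟶ E₂) (φ' : E₂ ⟶ E₁) (ψ χ : E₁ ⟶ E₁) :
    φ' ≫ (ψ + χ) ≫ φ = φ' ≫ ψ ≫ φ + φ' ≫ χ ≫ φ := by
  rw [Preadditive.add_comp, Preadditive.comp_add]

/-- **The transport commutes with the dual-endomorphism involution `α ↦ α† = t(α)·𝟙 − α`: `(φ'ψφ)† = φ' ψ† φ`** (the Rosati involutions correspond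
under an isogeny respecting the polarisations). [cite: SilvermanAEC2009, III §6 Thm. 6.2 (b)] [cite: Lange2023AbelianVarietiesComplex, §2.4 Lemma 2.4.1] -/
theorem isogenyTransport_trace_smul_id_sub {φ : E₁ ⟶ E₂} {φ' : E₂ ⟶ E₁} (hφ : φ ≫ φ' = (Nat.card (Hom.kerPoints (specOver ℂ ℂ) φ) : ℤ) • 𝟙 E₁)
    (ψ : E₁ ⟶ E₁) :
    LinearMap.trace ℤ _ (singularCohomology.map ℤ ℤ (AlgPoints.mapContinuous (L := ℂ) (φ' ≫ ψ ≫ φ).hom.hom.hom) 1).hom • 𝟙 E₂ - φ' ≫ ψ ≫ φ =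
      φ' ≫ (LinearMap.trace ℤ _ (singularCohomology.map ℤ ℤ (AlgPoints.mapContinuous (L := ℂ) ψ.hom.hom.hom) 1).hom • 𝟙 E₁ - ψ) ≫ φ := by
  rw [trace_isogenyTransport hφ, Preadditive.sub_comp, Preadditive.comp_sub, Preadditive.zsmul_comp, Preadditive.comp_zsmul, isogenyTransport_id h₁ h₂ hφ,
    smul_smul, mul_comm]

/-- **COMPLEX MULTIPLICATION IS TRANSPORTED: for `φ ≠ 0` and `ψ ∉ ℤ·𝟙`, `φ'ψφ ∉ ℤ·𝟙`** (the discriminant `t² − 4d` vanishes exactly on `ℤ·𝟙`, and it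
scales by `d(φ)² ≠ 0`). [cite: MumfordAV1970, §19 pp. 174–175] [cite: SilvermanAEC2009, V §2 Prop. 2.3] -/
theorem isogenyTransport_ne_zsmul_id {φ : E₁ ⟶ E₂} {φ' : E₂ ⟶ E₁} (hφ0 : φ ≠ 0)
    (hφ : φ ≫ φ' = (Nat.card (Hom.kerPoints (specOver ℂ ℂ) φ) : ℤ) • 𝟙 E₁)
    (hφd : Nat.card (Hom.kerPoints (specOver ℂ ℂ) φ') = Nat.card (Hom.kerPoints (specOver ℂ ℂ) φ)) {ψ : E₁ ⟶ E₁} (hψ : ∀ m : ℤ, ψ ≠ m • 𝟙 E₁)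
    (m : ℤ) : φ' ≫ ψ ≫ φ ≠ m • 𝟙 E₂ := by
  intro h
  have hsq := (trace_sq_eq_four_mul_det_iff_exists_eq_zsmul_id h₂ (φ' ≫ ψ ≫ φ)).2 ⟨m, h⟩
  have hlt := trace_sq_lt_four_mul_det_of_forall_ne_zsmul_id h₁ ψ hψ
  rw [← natCard_kerPoints_eq_det_singularCohomology_map_one] at hsq hlt
  have key := disc_isogenyTransport h₁ h₂ hφ hφd ψ
  have hpos : (0 : ℤ) < Nat.card (Hom.kerPoints (specOver ℂ ℂ) φ) := by
    exact_mod_cast (natCard_kerPoints_pos_iff_of_dim_eq_one h₁ h₂ φ).2 hφ0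
  nlinarith [sq_nonneg ((Nat.card (Hom.kerPoints (specOver ℂ ℂ) φ) : ℤ))]

/-! ### §2 Intertwined endomorphisms have equal trace, degree, discriminant and number of fixed points -/

/-- Plumbing: an intertwining relation transports along a dual pair to `φ' ≫ ψ₁ ≫ φ = d(φ)·ψ₂`. [cite: MumfordAV1970, §19 pp. 174–175] -/
theorem isogenyTransport_eq_zsmul_of_comp_eq_comp {φ : E₁ ⟶ E₂} {φ' : E₂ ⟶ E₁} (hφ : φ ≫ φ' = (Nat.card (Hom.kerPoints (specOver ℂ ℂ) φ) : ℤ) • 𝟙 E₁)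
    {ψ₁ : E₁ ⟶ E₁} {ψ₂ : E₂ ⟶ E₂} (h : φ ≫ ψ₂ = ψ₁ ≫ φ) :
    φ' ≫ ψ₁ ≫ φ = (Nat.card (Hom.kerPoints (specOver ℂ ℂ) φ) : ℤ) • ψ₂ := by
  rw [← h, ← Category.assoc, (comp_eq_natCard_kerPoints_zsmul_id_comm h₁ h₂ φ φ').1 hφ, Preadditive.zsmul_comp, Category.id_comp]

/-- **ISOGENY INVARIANCE OF THE TRACE: `φ ≫ ψ₂ = ψ₁ ≫ φ`, `φ ≠ 0 ⇒ t(ψ₁) = t(ψ₂)`** (`φ'ψ₁φ = φ'φψ₂ = d(φ)·ψ₂` and `t(φ'ψ₁φ) = d(φ)·t(ψ₁)`, `d(φ) ≠ 0`;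
Milne: `V_ℓ f` conjugates `V_ℓ ψ₁` into `V_ℓ ψ₂`). [cite: Milne1986AbelianVarieties, §12 Prop. 12.4 and Prop. 12.9] [cite: MumfordAV1970, §19 Thm. 4 and pp. 174–175] -/
theorem trace_eq_of_comp_eq_comp {φ : E₁ ⟶ E₂} (hφ0 : φ ≠ 0) {ψ₁ : E₁ ⟶ E₁} {ψ₂ : E₂ ⟶ E₂} (h : φ ≫ ψ₂ = ψ₁ ≫ φ) :
    LinearMap.trace ℤ _ (singularCohomology.map ℤ ℤ (AlgPoints.mapContinuous (L := ℂ) ψ₁.hom.hom.hom) 1).hom =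
      LinearMap.trace ℤ _ (singularCohomology.map ℤ ℤ (AlgPoints.mapContinuous (L := ℂ) ψ₂.hom.hom.hom) 1).hom := by
  obtain ⟨φ', hφ, -, -⟩ := exists_comp_eq_natCard_kerPoints_zsmul_id_of_dim_eq_one h₁ h₂ φ
  have ht := trace_isogenyTransport hφ ψ₁
  rw [isogenyTransport_eq_zsmul_of_comp_eq_comp h₁ h₂ hφ h, trace_zsmul'] at ht
  have hne : (Nat.card (Hom.kerPoints (specOver ℂ ℂ) φ) : ℤ) ≠ 0 := by
    exact_mod_cast ((natCard_kerPoints_pos_iff_of_dim_eq_one h₁ h₂ φ).2 hφ0).ne'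
  exact (mul_left_cancel₀ hne ht).symm

/-- **ISOGENY INVARIANCE OF THE DEGREE: `φ ≫ ψ₂ = ψ₁ ≫ φ`, `φ ≠ 0 ⇒ d(ψ₁) = d(ψ₂)`** (`d(φ)·d(ψ₂) = d(ψ₁)·d(φ)`).
[cite: Lange2023AbelianVarietiesComplex, §1.1.2 Prop. 1.1.13 (b)] [cite: Milne1986AbelianVarieties, §12 Prop. 12.4 and Prop. 12.9] -/
theorem natCard_kerPoints_eq_of_comp_eq_comp {φ : E₁ ⟶ E₂} (hφ0 : φ ≠ 0) {ψ₁ : E₁ ⟶ E₁} {ψ₂ : E₂ ⟶ E₂} (h : φ ≫ ψ₂ = ψ₁ ≫ φ) :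
    Nat.card (Hom.kerPoints (specOver ℂ ℂ) ψ₁) = Nat.card (Hom.kerPoints (specOver ℂ ℂ) ψ₂) := by
  have hd := natCard_kerPoints_comp_of_dim_eq_one h₁ h₂ φ ψ₂
  rw [h, natCard_kerPoints_comp_of_dim_eq_one h₁ h₁ ψ₁ φ, mul_comm] at hd
  exact Nat.eq_of_mul_eq_mul_left ((natCard_kerPoints_pos_iff_of_dim_eq_one h₁ h₂ φ).2 hφ0) hd

/-- **Intertwined endomorphisms have the same discriminant `t² − 4d`** (hence generate the same imaginary quadratic order `ℤ[ψ]`).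
[cite: MumfordAV1970, §19 Thm. 4 and pp. 174–175] [cite: SilvermanAEC2009, V §2 Prop. 2.3] -/
theorem disc_eq_of_comp_eq_comp {φ : E₁ ⟶ E₂} (hφ0 : φ ≠ 0) {ψ₁ : E₁ ⟶ E₁} {ψ₂ : E₂ ⟶ E₂} (h : φ ≫ ψ₂ = ψ₁ ≫ φ) :
    LinearMap.trace ℤ _ (singularCohomology.map ℤ ℤ (AlgPoints.mapContinuous (L := ℂ) ψ₁.hom.hom.hom) 1).hom ^ 2 -
        4 * Nat.card (Hom.kerPoints (specOver ℂ ℂ) ψ₁) =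
      LinearMap.trace ℤ _ (singularCohomology.map ℤ ℤ (AlgPoints.mapContinuous (L := ℂ) ψ₂.hom.hom.hom) 1).hom ^ 2 -
        4 * Nat.card (Hom.kerPoints (specOver ℂ ℂ) ψ₂) := by
  rw [trace_eq_of_comp_eq_comp h₁ h₂ hφ0 h, natCard_kerPoints_eq_of_comp_eq_comp h₁ h₂ hφ0 h]

/-- **INTERTWINED ENDOMORPHISMS HAVE THE SAME NUMBER OF FIXED POINTS: `|Ker(𝟙 − ψ₁)(ℂ)| = |Ker(𝟙 − ψ₂)(ℂ)|`** (`𝟙 − ψ₁` and `𝟙 − ψ₂` are again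
intertwined by `φ`; `#Fix(ψ) = deg(1 − ψ) = 1 − tr ψ + deg ψ`). [cite: SilvermanAEC2009, III §8 Prop. 8.6] [cite: Milne1986AbelianVarieties, §12 Prop. 12.9] -/
theorem natCard_kerPoints_id_sub_eq_of_comp_eq_comp {φ : E₁ ⟶ E₂} (hφ0 : φ ≠ 0) {ψ₁ : E₁ ⟶ E₁} {ψ₂ : E₂ ⟶ E₂} (h : φ ≫ ψ₂ = ψ₁ ≫ φ) :
    Nat.card (Hom.kerPoints (specOver ℂ ℂ) (𝟙 E₁ - ψ₁)) = Nat.card (Hom.kerPoints (specOver ℂ ℂ) (𝟙 E₂ - ψ₂)) :=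
  natCard_kerPoints_eq_of_comp_eq_comp h₁ h₂ hφ0 (by rw [Preadditive.comp_sub, Preadditive.sub_comp, Category.comp_id, Category.id_comp, h])

/-- **`ψ₁ = [m] ↔ ψ₂ = [m]` for intertwined endomorphisms** (`φ` is an epimorphism, and `χ ≫ φ = 0 ⇒ χ = 0`): in particular `ψ₁` is a complex
multiplication iff `ψ₂` is. [cite: MumfordAV1970, §19 pp. 174–175] [cite: SilvermanAEC2009, III §4 Prop. 4.2 (b)] -/
theorem eq_zsmul_id_iff_of_comp_eq_comp {φ : E₁ ⟶ E₂} (hφ0 : φ ≠ 0) {ψ₁ : E₁ ⟶ E₁} {ψ₂ : E₂ ⟶ E₂} (h : φ ≫ ψ₂ = ψ₁ ≫ φ) (m : ℤ) :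
    ψ₁ = m • 𝟙 E₁ ↔ ψ₂ = m • 𝟙 E₂ := by
  constructor
  · intro h1
    rw [h1, Preadditive.zsmul_comp, Category.id_comp] at h
    refine eq_of_sub_eq_zero (eq_zero_of_comp_eq_zero_of_ne_zero h₁ h₂ hφ0 ?_)
    rw [Preadditive.comp_sub, h, Preadditive.comp_zsmul, Category.comp_id, sub_self]
  · intro h2
    rw [h2, Preadditive.comp_zsmul, Category.comp_id] at h
    refine eq_of_sub_eq_zero (eq_zero_of_comp_eq_zero_of_ne_zero' h₁ h₂ h₁ hφ0 ?_)
    rw [Preadditive.sub_comp, ← h, Preadditive.zsmul_comp, Category.id_comp, sub_self]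

end Elliptic

end AbelianVariety

end Literature.AlgebraicGeometry.HodgeTheory
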